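import Literature.NumberTheory.Automorphic.RankinSelbergLocal
import Literature.NumberTheory.Automorphic.RankinSelbergLocalUniqueness
import Literature.NumberTheory.Automorphic.RankinSelbergLocalGLOne
import Literature.NumberTheory.Automorphic.RankinSelbergLocalEquiv
import Literature.NumberTheory.Automorphic.TateLocalFactorsProofs
import HarnessLib

/-!
# `hasRSGamma_tate_compatible`: the corrected statement, and its reduction to one test vector

Topic `Literature/NumberTheory/Automorphic`. Companion to `RankinSelbergLocal`, whose named fact
`hasRSGamma_tate_compatible π ψ μ` records the compatibility of the local Rankin–Selberg
`γ`-factor of `GL_n × GL_1` with Tate's theory (Jacquet–Piatetski-Shapiro–Shalika 1983, Thm. 3.1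
(multiplicativity of `γ`) with §2 (`n = m = 1` is Tate's local functional equation); Cogdell,
*Lectures on `L`-functions, converse theorems, and functoriality for `GL_n`*, §9): for `π`
irreducible admissible generic unramified with Satake parameters `χ_i(ϖ)` (`χ_i` unramified
quasi-characters), every quasi-character `χ` and `μ` THE SELF-DUAL HAAR MEASURE `dx` of `F`,
`γ(s, π × χ, ψ) = ∏ᵢ γ(s, χ_i χ, ψ)` (`HasRSGamma … (∏ γ_i)` from `HasTateGamma … (χ_i χ) (γ_i)`).

## The measure binders (why a corrected statement)

The fact is an M5 rewrite `theorem … := sorry` ↦ `def … : Prop`, and a `def` abstracts only the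
section variables its body uses. Of the original section
`variable [MeasurableSpace F] [BorelSpace F] (μ : Measure F) [μ.IsAddHaarMeasure]` only
`[MeasurableSpace F] (μ : Measure F)` survived (`#check @hasRSGamma_tate_compatible` ends
`… (π) (ψ) [MeasurableSpace F] (μ : Measure F) : Prop`; since the 2026-08-15 clean-up of
`RankinSelbergLocal` these two are written as a `variable … in`, the other two are gone). This is
the binder loss that made the four sibling facts false at `ν = 0` / `μ = 0` and led to their
corrected forms `existsUnique_hasRSLFactor_haar`, `existsUnique_hasRSGamma_haar`,
`hasRSLFactor_of_isSatakeParameter_haar`, `existsUnique_hasRSEpsilon_haar` (instances as binders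
of the defs). For `hasRSGamma_tate_compatible` the loss does not (visibly) change the truth value —
its hypothesis `IsSelfDualMeasure ψ μ` (Fourier self-inversion on Schwartz–Bruhat functions) fails
for the degenerate measures — but it changes the STATEMENT and blocks every proof from the cited
theorems: as elaborated the fact quantifies over EVERY σ-algebra on `F` and every measure `μ` on
it satisfying self-inversion, whereas

* the corrected local functional equation `existsUnique_hasRSGamma_haar` (JPSS Thm. 2.7 (iii)),
  the only source of the `γ`-factor, asks `[BorelSpace F] [μ.IsAddHaarMeasure]`;
* Tate's `existsUnique_hasTateGamma` asks `[μ.IsAddHaarMeasure]`, and even the proved uniqueness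
  `HasTateGamma.unique` (`TateLocalFactorsProofs`) — needed to know that the `γ_i` of the
  hypothesis `hγ` ARE Tate's factors, already for `n = 2` where `μ` does not enter the conclusion —
  asks `[BorelSpace F]` (a Haar measure on `Fˣ` must see the open subgroup `1 + 𝔭^k`);
* none of these instances follows from `IsSelfDualMeasure ψ μ` in Lean; mathematically the
  reduction "a measure on `(F, Σ)` with `𝓕_μ 𝓕_μ f = f(-·)` for all Schwartz–Bruhat `f` is the
  completion-restriction of the self-dual Haar measure" is an unpublished lemma (translation
  invariance via `𝓕(ψ(a·) f) = 𝓕f(· + a)` and injectivity of the Fourier–Stieltjes transform)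
  plus a transport of `Measure.pi` integrals between `Σ` and the Borel σ-algebra — a theory the
  sources never need, because for them `dx` is a Haar measure by definition (JPSS 1983, §2;
  Tate 1950, §2.2: "`dx` the additive Haar measure, self-dual for `ψ`").

So the published theorem is the same body AT a Borel additive Haar measure `μ` (self-dual for `ψ`
by the inner hypothesis): `hasRSGamma_tate_compatible_haar` below, with `[BorelSpace F]`,
`[μ.IsAddHaarMeasure]` as binders of the def — the pattern of the four `…_haar` facts of
`RankinSelbergLocal` and of `hasRSEpsilon_ne_zero_haar` (`RankinSelbergLocalCorrected`). The old
def is kept verbatim (it has no dependents); at such `μ` the two coincide by definition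
(`hasRSGamma_tate_compatible_haar_iff`), so `RankinSelbergLocalGLOne`, `RankinSelbergLocalEquiv`
and `RankinSelbergLocalUniqueness` serve the corrected statement unchanged.

## Contents (all proved; no new closed fact, D-0026)

* `HasRSGamma.eq_of_testVector`, `HasRSGamma.of_testVector` (any `m < n`): **a `γ`-factor is
  identified by one test pair** — if the functional equation holds with some `γ₀` for all
  Whittaker pairs (JPSS Thm. 2.7 (iii)) and ONE pair `W_v ∈ 𝒲(π, ψ)`, `W'_{v'} ∈ 𝒲(π', ψ⁻¹)`
  has `Ψ(s; W_v, W'_{v'}) = R(q^{-s}) ≢ 0` and `Ψ̃(1 - s; ρ(w_{n,m}) W̃_v, W̃'_{v'}) =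
  ω_{π'}(-1)^{n-1} γ R`, then `γ₀ = γ` (`EqOnRightHalfPlane.unique`, `EqOnLeftHalfPlane.unique`,
  `hasCentralCharacter_apply_eq`), hence the functional equation holds with `γ`. This is how
  `γ`-factors are computed in the sources once Thm. 2.7 is known (JPSS 1983, §2 (2.7)–(2.8) for
  `n = m = 1`; Jacquet–Shalika 1981, §2 for the unramified pairs).
* `hasRSGamma_tate_compatible_haar` (corrected cited statement), `…_iff` (definitional agreement
  with the old `Prop` at a Borel Haar `μ`), `…_of` (the old closed reading implies it),
  `…_of_equiv` (isomorphism invariance, from `hasRSGamma_tate_compatible_of_equiv`),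
  `prod_eq_prod_of_hasTateGamma` (under the corrected binders the hypothesis `hγ` pins `∏ γ_i`:
  Tate's factors are unique, `HasTateGamma.unique`).
* `hasRSGamma_tate_compatible_haar_of_testVector`: **the corrected fact reduces to** (C1) the
  local functional equation of JPSS Thm. 2.7 (iii) for the pairs `(π, χ ∘ det)`, i.e. the named
  fact `existsUnique_hasRSGamma_haar` at `m = 1` (its hypotheses on `π' = glOneRep χ` —
  irreducible, admissible, `ψ⁻¹`-generic — are theorems of `RankinSelbergLocalGLOne`, with
  `isOpen_ker_quasiChar_holds`), and (C2) the functional equation with `∏ γ_i` for ONE Whittaker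
  pair with `Ψ ≢ 0` (the unramified computation with the spherical vector for `χ` unramified,
  JPSS §2 / Jacquet–Shalika 1981 §2, and a unipotent translate of it — a Gauss sum — for `χ`
  ramified). No classification of unramified generic representations is needed on this route.

## References

* H. Jacquet, I. I. Piatetski-Shapiro, J. A. Shalika, *Rankin–Selberg convolutions*, Amer. J.
  Math. 105 (1983), 367–464, §2 ((2.7): `n = m = 1` is Tate's integral), Thm. 2.7 (iii), Thm. 3.1
  (multiplicativity of `γ`). [JacquetPiatetskiShapiroShalika1983]
* J. W. Cogdell, *Analytic theory of `L`-functions for `GL_n`*, in Bernstein–Gelbart (eds.), *An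
  Introduction to the Langlands Program* (2004), §3.1, Thm. 3.2 (p. 194), "Multiplicativity of
  `γ`" (p. 196). [CogdellAnalyticTheory2004]
* J. Tate, *Fourier analysis in number fields and Hecke's zeta-functions* (1950), §2.2 (self-dual
  `dx`), Thm. 2.4.1. [Tate1950]
-/

set_option autoImplicit false

open MeasureTheory Polynomial ValuativeRel
  Literature.NumberTheory.GaloisRepresentations.IsNonarchimedeanLocalField

noncomputable section

namespace Literature.NumberTheory.Automorphic

/-! ### A `γ`-factor is identified by one test pair -/

section TestVector

variable {F : Type*} [Field F] [ValuativeRel F] [TopologicalSpace F] [IsNonarchimedeanLocalField F]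
  {n m : ℕ} {V : Type*} [AddCommGroup V] [Module ℂ V] {V' : Type*} [AddCommGroup V'] [Module ℂ V']
  [MeasurableSpace (GL (Fin m) F ⧸ upperUnitriangular (Fin m) F)]
  {hmn : m < n} {π : Representation ℂ (GL (Fin n) F) V} {π' : Representation ℂ (GL (Fin m) F) V'}
  {ψ : AddChar F Circle} {ν : Measure (GL (Fin m) F ⧸ upperUnitriangular (Fin m) F)}
  [MeasurableSpace F] {μ : Measure F}

/-- **A `γ`-factor is identified by one test pair.** Let the local functional equation hold with
`γ₀` for all Whittaker pairs (`HasRSGamma hmn π π' ψ μ ν γ₀`, Jacquet–Piatetski-Shapiro–Shalika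
1983, Thm. 2.7 (iii)), let `ω` be a central character of `π'` (`V' ≠ 0`), and suppose that for ONE
pair of Whittaker functions `W_v ∈ 𝒲(π, ψ)`, `W'_{v'} ∈ 𝒲(π', ψ⁻¹)` the zeta integral
`Ψ(s; W_v, W'_{v'})` is interpolated on a right half-plane by `R ≠ 0`, the contragredient integral
`Ψ̃(1 - s; ρ(w_{n,m}) W̃_v, W̃'_{v'})` on a left half-plane by `R̃`, and `R̃ = ω(-1)^{n-1} γ R`.
Then `γ₀ = γ`: the interpolating rational functions of the functional equation for this pair are
the same `R`, `R̃` (`EqOnRightHalfPlane.unique`, `EqOnLeftHalfPlane.unique`), the central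
character is the same (`hasCentralCharacter_apply_eq`), and `R ≠ 0`, `ω(-1) ≠ 0` cancel. This is
how `γ(s, π × π', ψ)` is computed from a single pair once the functional equation is known
(JPSS 1983, §2, (2.7)–(2.8); Jacquet–Shalika 1981, §2).
[cite: JacquetPiatetskiShapiroShalika1983, Thm. 2.7 (iii)] -/
theorem HasRSGamma.eq_of_testVector [Nontrivial V'] {γ₀ γ : RatFunc ℂ}
    (h₀ : HasRSGamma hmn π π' ψ μ ν γ₀)
    {ω : Subgroup.center (GL (Fin m) F) →* ℂˣ} (hω : π'.HasCentralCharacter ω)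
    {Λ : Module.Dual ℂ V} (hΛ : Λ ∈ whittakerFunctionals π ψ)
    {Λ' : Module.Dual ℂ V'} (hΛ' : Λ' ∈ whittakerFunctionals π' ψ⁻¹) {v : V} {v' : V'}
    {R Rt : RatFunc ℂ}
    (hR : EqOnRightHalfPlane (residueFieldCard F)
      (rsZeta hmn ν (whittakerModel π Λ v) (whittakerModel π' Λ' v')) R)
    (hRt : EqOnLeftHalfPlane (residueFieldCard F)
      (fun s => rsZetaTilde hmn μ ν (fun g => tildeFn (whittakerModel π Λ v) (g * weylNM F hmn.le))
        (tildeFn (whittakerModel π' Λ' v')) (1 - s)) Rt)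
    (hR0 : R ≠ 0)
    (hE : Rt = RatFunc.C ((((ω (centerNegOne m F)) : ℂˣ) : ℂ) ^ (n - 1)) * γ * R) :
    γ₀ = γ := by
  have hq : 1 < residueFieldCard F := one_lt_residueFieldCard F
  obtain ⟨ω₀, hω₀, H⟩ := h₀
  obtain ⟨R₀, Rt₀, hR₀, hRt₀, hE₀⟩ := H Λ hΛ Λ' hΛ' v v'
  have hu : ω₀ (centerNegOne m F) = ω (centerNegOne m F) := hasCentralCharacter_apply_eq hω₀ hω _
  rw [hR₀.unique hq hR, hRt₀.unique hq hRt, hu, hE] at hE₀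
  have hC : RatFunc.C ((((ω (centerNegOne m F)) : ℂˣ) : ℂ) ^ (n - 1)) ≠ 0 :=
    (_root_.map_ne_zero RatFunc.C).mpr (pow_ne_zero _ (Units.ne_zero _))
  exact (mul_left_cancel₀ hC (mul_right_cancel₀ hR0 hE₀)).symm

/-- **The functional equation with the computed `γ`.** Under the hypotheses of
`HasRSGamma.eq_of_testVector` (the functional equation holds with some `γ₀`, and one Whittaker
pair with `Ψ ≢ 0` exhibits it with `γ`), `HasRSGamma hmn π π' ψ μ ν γ`.
[cite: JacquetPiatetskiShapiroShalika1983, Thm. 2.7 (iii)] -/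
theorem HasRSGamma.of_testVector [Nontrivial V'] {γ₀ γ : RatFunc ℂ}
    (h₀ : HasRSGamma hmn π π' ψ μ ν γ₀)
    {ω : Subgroup.center (GL (Fin m) F) →* ℂˣ} (hω : π'.HasCentralCharacter ω)
    {Λ : Module.Dual ℂ V} (hΛ : Λ ∈ whittakerFunctionals π ψ)
    {Λ' : Module.Dual ℂ V'} (hΛ' : Λ' ∈ whittakerFunctionals π' ψ⁻¹) {v : V} {v' : V'}
    {R Rt : RatFunc ℂ}
    (hR : EqOnRightHalfPlane (residueFieldCard F)
      (rsZeta hmn ν (whittakerModel π Λ v) (whittakerModel π' Λ' v')) R)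
    (hRt : EqOnLeftHalfPlane (residueFieldCard F)
      (fun s => rsZetaTilde hmn μ ν (fun g => tildeFn (whittakerModel π Λ v) (g * weylNM F hmn.le))
        (tildeFn (whittakerModel π' Λ' v')) (1 - s)) Rt)
    (hR0 : R ≠ 0)
    (hE : Rt = RatFunc.C ((((ω (centerNegOne m F)) : ℂˣ) : ℂ) ^ (n - 1)) * γ * R) :
    HasRSGamma hmn π π' ψ μ ν γ :=
  h₀.eq_of_testVector hω hΛ hΛ' hR hRt hR0 hE ▸ h₀

end TestVector

/-! ### The corrected statement -/

section Corrected

variable {F : Type*} [Field F] [ValuativeRel F] [TopologicalSpace F] [IsNonarchimedeanLocalField F]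
  {n : ℕ} {V : Type*} [AddCommGroup V] [Module ℂ V] {W : Type*} [AddCommGroup W] [Module ℂ W]

/-- **Compatibility of `γ(s, π × χ, ψ)` with Tate's theory — corrected statement**
(Jacquet–Piatetski-Shapiro–Shalika 1983, Thm. 3.1 (multiplicativity of `γ`-factors) with §2,
(2.7) for `n = m = 1` (= Tate's local functional equation, Tate 1950, Thm. 2.4.1); Cogdell,
*Analytic theory of `L`-functions for `GL_n`*, "Multiplicativity of `γ`", p. 196). For `F` a
non-archimedean local field WITH ITS BOREL σ-ALGEBRA, `μ` AN ADDITIVE HAAR MEASURE on `F`, `π` an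
irreducible admissible `ψ`-generic representation of `GL_n(F)`, `n ≥ 2`, which is unramified with
Satake parameters the values `χ_i(ϖ)` of unramified quasi-characters `χ_1, …, χ_n` at a
uniformiser `ϖ`, `ψ` non-trivial continuous, `μ` self-dual for `ψ`, `μ'` a Haar measure on `Fˣ`,
`ν₁` an invariant Borel measure on `GL_1(F) ⧸ U_1` finite on compacts and positive on opens, `χ`
any quasi-character and `γ_i ∈ ℂ(q^{-s})` Tate's factors of `χ_i χ` (`HasTateGamma ψ μ μ' (χ_i χ)
γ_i`): the local functional equation of `π × (χ ∘ det)` holds with `γ = ∏ᵢ γ_i`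
(`HasRSGamma hn π (glOneRep χ) ψ μ ν₁ (∏ γ_i)`). This CORRECTS
`Literature.NumberTheory.Automorphic.hasRSGamma_tate_compatible`, whose `def` lost the section
instances `[BorelSpace F] [μ.IsAddHaarMeasure]` (binders of the def here; same body otherwise,
`hasRSGamma_tate_compatible_haar_iff`) and therefore ranges over all σ-algebras on `F` and all
measures with Schwartz–Bruhat Fourier self-inversion, where neither JPSS Thm. 2.7
(`existsUnique_hasRSGamma_haar`) nor Tate's uniqueness (`HasTateGamma.unique`) can be invoked; see
the module docstring. [cite: JacquetPiatetskiShapiroShalika1983, Thm. 3.1 and §2 (2.7)] -/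
def hasRSGamma_tate_compatible_haar (π : Representation ℂ (GL (Fin n) F) V) (ψ : AddChar F Circle)
    [MeasurableSpace F] [BorelSpace F] (μ : Measure F) [μ.IsAddHaarMeasure] : Prop :=
  hasRSGamma_tate_compatible π ψ μ

variable (π : Representation ℂ (GL (Fin n) F) V) (ψ : AddChar F Circle)
  [MeasurableSpace F] [BorelSpace F] (μ : Measure F) [μ.IsAddHaarMeasure]

/-- At a Borel additive Haar measure `μ` the corrected fact *is* the old `Prop`
`hasRSGamma_tate_compatible π ψ μ` (same body), so the files about the latter
(`RankinSelbergLocalGLOne`, `RankinSelbergLocalEquiv`, `RankinSelbergLocalUniqueness`) serve it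
unchanged. [folklore] -/
theorem hasRSGamma_tate_compatible_haar_iff :
    hasRSGamma_tate_compatible_haar π ψ μ ↔ hasRSGamma_tate_compatible π ψ μ :=
  Iff.rfl

/-- The old closed reading (all σ-algebras, all self-inverting measures) implies the corrected
statement; the correction only removes instances that no source considers. [folklore] -/
theorem hasRSGamma_tate_compatible_haar_of (h : hasRSGamma_tate_compatible π ψ μ) :
    hasRSGamma_tate_compatible_haar π ψ μ :=
  h

variable {π} in
/-- **The corrected fact is an isomorphism invariant**: it holds for `π` as soon as it holds for
some `σ ≃ π` (`hasRSGamma_tate_compatible_of_equiv` of `RankinSelbergLocalEquiv`: irreducibility,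
admissibility, genericity and Satake parameters pass along `e`, `HasRSGamma` passes back) — the
step "without loss of generality `π` is a model, e.g. `Ind(χ_1, …, χ_n)`" (Cogdell, p. 195).
[cite: JacquetPiatetskiShapiroShalika1983, Thm. 3.1 and §2 (2.7)] -/
theorem hasRSGamma_tate_compatible_haar_of_equiv {σ : Representation ℂ (GL (Fin n) F) W}
    (e : π.Equiv σ) (h : hasRSGamma_tate_compatible_haar σ ψ μ) :
    hasRSGamma_tate_compatible_haar π ψ μ :=
  hasRSGamma_tate_compatible_of_equiv e h

omit [μ.IsAddHaarMeasure] in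
/-- **Under the corrected binders the hypothesis `hγ` pins `∏ γ_i`.** With `F` Borel and `μ'`
Haar on `Fˣ`, Tate's `γ`-factor of each `χ_i χ` is unique (`HasTateGamma.unique`,
`TateLocalFactorsProofs`; Tate 1950, Thm. 2.4.1), so two families `γ, γ'` as in the fact have the
same product: the conclusion `HasRSGamma … (∏ γ_i)` speaks about THE Tate factors. (Without
`[BorelSpace F]` this uniqueness is not available.) [cite: Tate1950, Thm. 2.4.1] -/
theorem prod_eq_prod_of_hasTateGamma (μ' : Measure Fˣ) [μ'.IsHaarMeasure] {ι : Type*}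
    (s : Finset ι) (χ : ι → QuasiChar F) {γ γ' : ι → RatFunc ℂ}
    (hγ : ∀ i ∈ s, HasTateGamma ψ μ μ' (χ i) (γ i)) (hγ' : ∀ i ∈ s, HasTateGamma ψ μ μ' (χ i) (γ' i)) :
    ∏ i ∈ s, γ i = ∏ i ∈ s, γ' i :=
  Finset.prod_congr rfl fun i hi => (hγ i hi).unique (hγ' i hi)

/-- **Reduction of the corrected fact to the local functional equation and ONE test pair.**
Suppose
(C1) the local functional equation of Jacquet–Piatetski-Shapiro–Shalika (1983, Thm. 2.7 (iii))
for the pairs `(π, χ ∘ det)`, `n ≥ 2`, i.e. the named fact `existsUnique_hasRSGamma_haar` of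
`RankinSelbergLocal` at `m = 1`, for every invariant `ν₁` and every quasi-character `χ`; and
(C2) for all data of the fact, ONE Whittaker pair `W_v ∈ 𝒲(π, ψ)`, `χ(det ·) Λ'(v')` whose zeta
integral is a non-zero rational function `R` and whose contragredient integral is
`χ(-1)^{n-1} (∏ γ_i) R` — the unramified computation (spherical vector, `χ` unramified:
JPSS 1983 §2, Jacquet–Shalika 1981 §2) or its unipotent translate (`χ` ramified).
Then `hasRSGamma_tate_compatible_haar π ψ μ`: `π' = glOneRep χ` is irreducible, admissible
(`ker χ` is open, `isOpen_ker_quasiChar_holds`) and `ψ⁻¹`-generic (`RankinSelbergLocalGLOne`), so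
(C1) yields some `γ₀`, and `HasRSGamma.of_testVector` with the central character `χ ∘ det`
(`glOneRep_hasCentralCharacter`, `ω(-1) = χ(-1)`) replaces `γ₀` by `∏ γ_i`.
[cite: JacquetPiatetskiShapiroShalika1983, Thm. 2.7 (iii) and Thm. 3.1] -/
theorem hasRSGamma_tate_compatible_haar_of_testVector
    (hC1 : ∀ (hn : 1 < n) [MeasurableSpace (GL (Fin 1) F ⧸ upperUnitriangular (Fin 1) F)]
      [BorelSpace (GL (Fin 1) F ⧸ upperUnitriangular (Fin 1) F)]
      (ν₁ : Measure (GL (Fin 1) F ⧸ upperUnitriangular (Fin 1) F))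
      [SMulInvariantMeasure (GL (Fin 1) F) (GL (Fin 1) F ⧸ upperUnitriangular (Fin 1) F) ν₁]
      [IsFiniteMeasureOnCompacts ν₁] [ν₁.IsOpenPosMeasure] (χ : QuasiChar F),
      existsUnique_hasRSGamma_haar hn π (glOneRep (χ : Fˣ →* ℂˣ)) ψ ν₁ μ)
    (hC2 : ∀ (hn : 1 < n) [π.IsIrreducible], π.IsAdmissible → IsGeneric π ψ →
      ψ.IsContinuousNontrivial → IsSelfDualMeasure ψ μ → ∀ (μ' : Measure Fˣ) [μ'.IsHaarMeasure]
      [MeasurableSpace (GL (Fin 1) F ⧸ upperUnitriangular (Fin 1) F)]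
      [BorelSpace (GL (Fin 1) F ⧸ upperUnitriangular (Fin 1) F)]
      (ν₁ : Measure (GL (Fin 1) F ⧸ upperUnitriangular (Fin 1) F))
      [SMulInvariantMeasure (GL (Fin 1) F) (GL (Fin 1) F ⧸ upperUnitriangular (Fin 1) F) ν₁]
      [IsFiniteMeasureOnCompacts ν₁] [ν₁.IsOpenPosMeasure] {ϖ : Fˣ},
      (valuation F).IsUniformizer (ϖ : F) →
      ∀ (χs : Fin n → QuasiChar F), (∀ i, (χs i).IsUnramified) →
      IsSatakeParameter π ϖ (Finset.univ.val.map fun i => ((χs i ϖ : ℂˣ) : ℂ)) →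
      ∀ (χ : QuasiChar F) (γ : Fin n → RatFunc ℂ),
      (∀ i, HasTateGamma ψ μ μ' (χs i * χ) (γ i)) →
      ∃ Λ ∈ whittakerFunctionals π ψ, ∃ (Λ' : Module.Dual ℂ ℂ) (v : V) (v' : ℂ) (R Rt : RatFunc ℂ),
        EqOnRightHalfPlane (residueFieldCard F)
          (rsZeta hn ν₁ (whittakerModel π Λ v) (whittakerModel (glOneRep (χ : Fˣ →* ℂˣ)) Λ' v'))
          R ∧
        EqOnLeftHalfPlane (residueFieldCard F)
          (fun s => rsZetaTilde hn μ ν₁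
            (fun g => tildeFn (whittakerModel π Λ v) (g * weylNM F hn.le))
            (tildeFn (whittakerModel (glOneRep (χ : Fˣ →* ℂˣ)) Λ' v')) (1 - s)) Rt ∧
        R ≠ 0 ∧ Rt = RatFunc.C (((χ (-1) : ℂˣ) : ℂ) ^ (n - 1)) * (∏ i, γ i) * R) :
    hasRSGamma_tate_compatible_haar π ψ μ := by
  intro hn _ hπ hg hψ hμ μ' _ _ _ ν₁ _ _ _ ϖ hϖ χs hunr hα χ γ hγ
  haveI : (glOneRep (χ : Fˣ →* ℂˣ)).IsIrreducible := isIrreducible_glOneRep _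
  have hadm : (glOneRep (χ : Fˣ →* ℂˣ)).IsAdmissible :=
    isAdmissible_glOneRep (isOpen_ker_quasiChar_holds χ)
  have hgen : IsGeneric (glOneRep (χ : Fˣ →* ℂˣ)) ψ⁻¹ := isGeneric_of_fin_one _ _
  obtain ⟨γ₀, hγ₀, -⟩ := hC1 hn ν₁ χ hπ hadm hg hgen hψ
  obtain ⟨Λ, hΛ, Λ', v, v', R, Rt, hR, hRt, hR0, hE⟩ :=
    hC2 hn hπ hg hψ hμ μ' ν₁ hϖ χs hunr hα χ γ hγ
  have hΛ' : Λ' ∈ whittakerFunctionals (glOneRep (χ : Fˣ →* ℂˣ)) ψ⁻¹ := by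
    rw [whittakerFunctionals_eq_top_of_fin_one]; trivial
  refine hγ₀.of_testVector (glOneRep_hasCentralCharacter _) hΛ hΛ' hR hRt hR0 ?_
  rwa [glOneCentralChar_centerNegOne]

end Corrected

end Literature.NumberTheory.Automorphic
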